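import Summits.FinalStateConjecture.FinalStateConjecture.Theorems.PhotonSphereChannelsTameCensorshipExactRegionCausality
import Summits.FinalStateConjecture.FinalStateConjecture.Theorems.PhotonSphereChannelsChannelsResolveTameDevelopmentsRFutureEscapingPaths
import HarnessLib

/-!
# Crux `TameCensorship` (stmt-FinalStateConjecture-10047), line `crush-the-swallowed-interior`:
# the entry lemma of clause (B4) of stub B — a point seen from a complete ray that misses the
# swallowed region is an exact point

Clause (B4) of the registered stub `stub_exactKerrBookkeeping` concerns the points
`q ∈ J⁺(ιX) ∩ I⁻(γ⁺)` in the chronological past of the future half `γ⁺ = γ(dom ∩ [0, ∞))` of a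
future-complete normalised null ray `γ` from the datum, and offers the alternative: `γ⁺` meets
`swallowed = J⁺(ιK)`, or `q` carries a bounded-geometry chart. This file proves the def-free
reduction of the second alternative to the exact region `E = J⁺(ιX) ∖ swallowed`:

* `nullRay_image_subset_exactRegion` — if `γ⁺` misses `swallowed`, then `γ⁺ ⊆ E` (the future
  half of a complete normalised null ray lies in `J⁺(ιX)`,
  `nullRay_apply_mem_causalFuture_range` of the route's `…FutureEscapingPaths`);
* `mem_exactRegion_of_nullRay` — hence every `q ∈ J⁺(ιX) ∩ I⁻(γ⁺)` lies in `E`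
  (`mem_exactRegion_of_mem_chronologicalPast`): the bounded-geometry chart of (B4) is to be
  produced at an EXACT-Kerr point, through the exact chart `χ` of clause (B1).

References: O'Neill 1983, Ch. 14, pp. 402–403; Hawking–Ellis 1973, §6.5–6.6.
-/

noncomputable section

-- The tree namespace `Summit.FinalStateConjecture.FinalStateConjecture.…` (summit = sub-problem)
-- repeats a component by design (D-0022), which the `dupNamespace` linter would flag on every decl.
set_option linter.dupNamespace false

open scoped Manifold ContDiff Topology
open Set Filter Function TopologicalSpace Topology
open Literature.Geometry.Lorentzian

namespace Summit.FinalStateConjecture.FinalStateConjecture.Theorems.PhotonSphereChannels.TameCensorshipCrush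

variable {X : Type} [TopologicalSpace X] [ChartedSpace E3 X] [IsManifold (𝓡 3) ∞ X]
  [ConnectedSpace X] {D : InitialDataSet (𝓡 3) X}

/-- **The future half of a complete normalised null ray that misses `J⁺(T)` lies in the exact
region `J⁺(ιX) ∖ J⁺(T)`**: its points are in `J⁺(ιX)` (`nullRay_apply_mem_causalFuture_range`)
and, by hypothesis, not in `J⁺(T)`. [cite: ONeillSemiRiemannian1983, Ch. 14, pp. 402–403] -/
theorem nullRay_image_subset_exactRegion (𝒟 : VacuumCauchyDevelopment D) [𝒟.metric.HasLeviCivita]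
    (T : Set 𝒟.carrier) {p : X} {γ : ℝ → 𝒟.carrier} {dom : Set ℝ}
    (hray : 𝒟.metric.IsNormalisedNullRayFrom 𝒟.timeOrientation 𝒟.embed 𝒟.normal p γ dom)
    (hunb : ¬ BddAbove dom)
    (hmiss : ¬ (γ '' (dom ∩ Ici 0) ∩ 𝒟.metric.causalFuture 𝒟.timeOrientation T).Nonempty) :
    γ '' (dom ∩ Ici 0) ⊆
      𝒟.metric.causalFuture 𝒟.timeOrientation (range 𝒟.embed) \
        𝒟.metric.causalFuture 𝒟.timeOrientation T := by
  rintro _ ⟨t, ⟨htd, ht⟩, rfl⟩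
  refine ⟨nullRay_apply_mem_causalFuture_range 𝒟 hray hunb ht, fun hT ↦ hmiss ?_⟩
  exact ⟨γ t, ⟨t, ⟨htd, ht⟩, rfl⟩, hT⟩

/-- **The entry lemma of clause (B4)**: a point `q ∈ J⁺(ιX)` in the chronological past of the
future half of a complete normalised null ray that misses `J⁺(T)` lies in the exact region
`J⁺(ιX) ∖ J⁺(T)` (`E` is past-convex inside `J⁺(ιX)`, `mem_exactRegion_of_mem_chronologicalPast`).
[cite: ONeillSemiRiemannian1983, Ch. 14, pp. 402–403] -/
theorem mem_exactRegion_of_nullRay (𝒟 : VacuumCauchyDevelopment D) [𝒟.metric.HasLeviCivita]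
    (T : Set 𝒟.carrier) {p : X} {γ : ℝ → 𝒟.carrier} {dom : Set ℝ}
    (hray : 𝒟.metric.IsNormalisedNullRayFrom 𝒟.timeOrientation 𝒟.embed 𝒟.normal p γ dom)
    (hunb : ¬ BddAbove dom)
    (hmiss : ¬ (γ '' (dom ∩ Ici 0) ∩ 𝒟.metric.causalFuture 𝒟.timeOrientation T).Nonempty)
    {q : 𝒟.carrier} (hqS : q ∈ 𝒟.metric.causalFuture 𝒟.timeOrientation (range 𝒟.embed))
    (hqγ : q ∈ 𝒟.metric.chronologicalPast 𝒟.timeOrientation (γ '' (dom ∩ Ici 0))) :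
    q ∈ 𝒟.metric.causalFuture 𝒟.timeOrientation (range 𝒟.embed) \
      𝒟.metric.causalFuture 𝒟.timeOrientation T :=
  mem_exactRegion_of_mem_chronologicalPast 𝒟.toCauchyDevelopment (range 𝒟.embed) T
    (nullRay_image_subset_exactRegion 𝒟 T hray hunb hmiss) hqS hqγ

end Summit.FinalStateConjecture.FinalStateConjecture.Theorems.PhotonSphereChannels.TameCensorshipCrush

end
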